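import Literature.NumberTheory.Sieve.RankinComposedTail
import Mathlib.NumberTheory.ArithmeticFunction.Misc
import Mathlib.NumberTheory.SmoothNumbers
import Mathlib.Data.Nat.Factorization.Basic
import HarnessLib

/-!
# Elementary lemmas for the dispersion assembly of a shifted-Liouville Type-I₂ sum

Topic `Literature/NumberTheory/Sieve`.  Everything in this file is PROVED and generic (Mathlib + the tree's
Rankin tail `RankinComposed.sum_inv_le_rankin`): the bookkeeping used when a trilinear sum
`∑_{q} ∑_{r} |∑_{s} ∑_{n} f(r s n + c)|` is cut into a Bombieri–Vinogradov range and a dispersion range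
(Drappeau 2017, §6; Fouvry–Tenenbaum 2021, §§5–7), namely

* `smoothComponent N s = (s, N^∞)`, `roughComponent N s = s/(s, N^∞)` and their API (product, coprimality,
  factoredness, uniqueness of `s = P t` with `P ∣ N^∞`, `(t, N) = 1`);
* the Rankin tail `∑_{s ≤ S, (s,N^∞) > P_m} 1/s ≤ P_m^{-1/2} 4^{ω(N)} ∑_{t ≤ S} 1/t`
  (`sum_inv_filter_smoothComponent_le`, via `∏_{p ∣ N}(1 - p^{-1/2})⁻¹ ≤ 4^{ω(N)}`);
* summing over one residue class as a Bombieri–Vinogradov prefix (`sum_Icc_filter_modEq`), the multiplicity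
  of a modulus `#{(q,r,s) : lcm(rs, q) = d} ≤ τ(d)³` (`card_lcm_fiber_le`);
* a dyadic cut (`exists_dyadic_cut`) and three `x^{1-κ}(log x)^B ≤ x/(log x)^A` numerics.

## References
* S. Drappeau, Proc. LMS 114 (2017), §6; É. Fouvry, G. Tenenbaum, Trans. AMS 375 (2022), §§5–7.
* H. L. Montgomery, R. C. Vaughan, *Multiplicative Number Theory I*, CUP 2007, §7.1 (Rankin's method).
-/

noncomputable section

open Finset Real
open scoped ArithmeticFunction.sigma

namespace Literature.NumberTheory.Sieve

namespace DispersionAssembly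

/-! ### Smooth and rough components relative to a fixed `N` -/

/-- The `N`-smooth part `(s, N^∞) = ∏_{p ∣ N} p^{v_p(s)}` of `s`. [folklore] -/
def smoothComponent (N s : ℕ) : ℕ :=
  s.factorization.prod fun p k => if p ∣ N then p ^ k else 1

/-- The `N`-rough (coprime-to-`N`) part `∏_{p ∤ N} p^{v_p(s)}` of `s`. [folklore] -/
def roughComponent (N s : ℕ) : ℕ :=
  s.factorization.prod fun p k => if p ∣ N then 1 else p ^ k

/-- `(s, N^∞) · (N-rough part) = s`. [folklore] -/
theorem smoothComponent_mul_roughComponent (N : ℕ) {s : ℕ} (hs : s ≠ 0) : smoothComponent N s * roughComponent N s = s := by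
  unfold smoothComponent roughComponent
  rw [← Finsupp.prod_mul]
  conv_rhs => rw [← Nat.prod_factorization_pow_eq_self hs]
  refine Finsupp.prod_congr fun p _ => ?_
  split_ifs <;> simp

/-- The rough part is coprime to `N`. [folklore] -/
theorem roughComponent_coprime (N s : ℕ) : Nat.Coprime (roughComponent N s) N := by
  unfold roughComponent Finsupp.prod
  refine Nat.Coprime.prod_left fun p hp => ?_
  rw [Nat.support_factorization] at hp
  have hpp : p.Prime := Nat.prime_of_mem_primeFactors hp
  dsimp only
  split_ifs with h
  · exact Nat.coprime_one_left _
  · exact Nat.Coprime.pow_left _ ((Nat.Prime.coprime_iff_not_dvd hpp).2 h)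

/-- The smooth part is nonzero. [folklore] -/
theorem smoothComponent_ne_zero (N s : ℕ) : smoothComponent N s ≠ 0 := by
  unfold smoothComponent Finsupp.prod
  refine Finset.prod_ne_zero_iff.2 fun p hp => ?_
  rw [Nat.support_factorization] at hp
  have hpp : p.Prime := Nat.prime_of_mem_primeFactors hp
  dsimp only
  split_ifs
  · exact pow_ne_zero _ hpp.ne_zero
  · exact one_ne_zero

/-- The rough part is nonzero. [folklore] -/
theorem roughComponent_ne_zero (N s : ℕ) : roughComponent N s ≠ 0 := by
  unfold roughComponent Finsupp.prod
  refine Finset.prod_ne_zero_iff.2 fun p hp => ?_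
  rw [Nat.support_factorization] at hp
  have hpp : p.Prime := Nat.prime_of_mem_primeFactors hp
  dsimp only
  split_ifs
  · exact one_ne_zero
  · exact pow_ne_zero _ hpp.ne_zero

/-- Every prime factor of the smooth part divides `N`. [folklore] -/
theorem dvd_of_prime_dvd_smoothComponent {N s p : ℕ} (hp : p.Prime) (h : p ∣ smoothComponent N s) : p ∣ N := by
  unfold smoothComponent Finsupp.prod at h
  obtain ⟨ℓ, hℓ, hdvd⟩ := (Prime.dvd_finsetProd_iff hp.prime _).1 h
  rw [Nat.support_factorization] at hℓ
  have hℓp : ℓ.Prime := Nat.prime_of_mem_primeFactors hℓ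
  dsimp only at hdvd
  split_ifs at hdvd with hℓN
  · have : p = ℓ := (Nat.prime_dvd_prime_iff_eq hp hℓp).1 (hp.dvd_of_dvd_pow hdvd)
    rw [this]; exact hℓN
  · exact absurd (Nat.le_of_dvd one_pos hdvd) (by have := hp.two_le; omega)

/-- The smooth part is an `N.primeFactors`-factored number (`N ≠ 0`). [folklore] -/
theorem smoothComponent_mem_factoredNumbers {N : ℕ} (hN : N ≠ 0) (s : ℕ) :
    smoothComponent N s ∈ Nat.factoredNumbers N.primeFactors := by
  rw [Nat.mem_factoredNumbers']
  intro p hp hdvd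
  exact Nat.mem_primeFactors.2 ⟨hp, dvd_of_prime_dvd_smoothComponent hp hdvd, hN⟩

/-- An `N.primeFactors`-factored number is coprime to every number coprime to `N`. [folklore] -/
theorem coprime_of_mem_factoredNumbers_primeFactors {N P t : ℕ} (hP : P ∈ Nat.factoredNumbers N.primeFactors)
    (ht : Nat.Coprime t N) : Nat.Coprime P t := by
  by_contra h
  obtain ⟨p, hp, hpd⟩ := Nat.exists_prime_and_dvd h
  have hpP : p ∣ P := hpd.trans (Nat.gcd_dvd_left _ _)
  have hpt : p ∣ t := hpd.trans (Nat.gcd_dvd_right _ _)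
  have hpN : p ∣ N := (Nat.mem_primeFactors.1 ((Nat.mem_factoredNumbers'.1 hP) p hp hpP)).2.1
  have h1 : p ∣ 1 := by
    rw [← Nat.Coprime.gcd_eq_one ht]
    exact Nat.dvd_gcd hpt hpN
  exact hp.one_lt.ne' (Nat.dvd_one.1 h1)

/-- Uniqueness of the decomposition `s = P t`, `P ∣ N^∞`, `(t, N) = 1`. [folklore] -/
theorem smoothComponent_eq_of_mul_eq {N P t s : ℕ} (hN : N ≠ 0) (hs : s ≠ 0)
    (hP : P ∈ Nat.factoredNumbers N.primeFactors) (ht : Nat.Coprime t N) (h : P * t = s) :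
    smoothComponent N s = P ∧ roughComponent N s = t := by
  have hdec := smoothComponent_mul_roughComponent N hs
  have hP' := smoothComponent_mem_factoredNumbers hN s
  have ht' := roughComponent_coprime N s
  -- `P ∣ P' t'` and `(P, t') = 1` give `P ∣ P'`; symmetrically `P' ∣ P`
  have h1 : P ∣ smoothComponent N s := by
    have : P ∣ smoothComponent N s * roughComponent N s := by rw [hdec, ← h]; exact Dvd.intro t rfl
    exact (coprime_of_mem_factoredNumbers_primeFactors hP ht').dvd_of_dvd_mul_right this
  have h2 : smoothComponent N s ∣ P := by
    have : smoothComponent N s ∣ P * t := by rw [h]; exact ⟨roughComponent N s, hdec.symm⟩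
    exact (coprime_of_mem_factoredNumbers_primeFactors hP' ht).dvd_of_dvd_mul_right this
  have hPeq : smoothComponent N s = P := Nat.dvd_antisymm h2 h1
  refine ⟨hPeq, ?_⟩
  have hP0 : P ≠ 0 := Nat.ne_zero_of_mem_factoredNumbers hP
  have : P * roughComponent N s = P * t := by
    rw [h]
    conv_rhs => rw [← hdec, hPeq]
  exact Nat.eq_of_mul_eq_mul_left (Nat.pos_of_ne_zero hP0) this

/-- `IsCoprime (t : ℤ) c ↔ Nat.Coprime t |c|`. [folklore] -/
theorem isCoprime_natCast_int_iff (t : ℕ) (c : ℤ) : IsCoprime (t : ℤ) c ↔ Nat.Coprime t c.natAbs := by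
  rw [Int.isCoprime_iff_gcd_eq_one, Int.gcd_eq_natAbs, Int.natAbs_natCast, Nat.Coprime]

/-! ### The Rankin tail over numbers with a large smooth component -/

/-- `1 ≤ log x` for `x ≥ 3`. [folklore] -/
theorem log_one_le_of_three_le {x : ℝ} (hx : 3 ≤ x) : 1 ≤ Real.log x := by
  rw [← Real.log_exp 1]
  refine Real.log_le_log (Real.exp_pos 1) (le_trans ?_ hx)
  have := Real.exp_one_lt_d9
  linarith

/-- `∏_{p ∣ N} (1 − p^{-1/2})⁻¹ ≤ 4^{ω(N)}` (each factor is `≤ (1 − 2^{-1/2})⁻¹ ≤ 4`). [folklore] -/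
theorem prod_primeFactors_rankin_le (N : ℕ) :
    ∏ p ∈ N.primeFactors, (1 - (p : ℝ) ^ (-(1 / 2 : ℝ)))⁻¹ ≤ (4 : ℝ) ^ N.primeFactors.card := by
  have h2 : (2 : ℝ) ^ (-(1 / 2 : ℝ)) ≤ 3 / 4 := by
    rw [Real.rpow_neg (by norm_num), ← Real.sqrt_eq_rpow]
    have hs : (4 / 3 : ℝ) < Real.sqrt 2 := by
      rw [Real.lt_sqrt (by norm_num)]; norm_num
    have h43 : (0 : ℝ) < 4 / 3 := by norm_num
    calc (Real.sqrt 2)⁻¹ ≤ (4 / 3 : ℝ)⁻¹ := by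
          rw [inv_le_inv₀ (h43.trans hs) h43]; exact hs.le
      _ = 3 / 4 := by norm_num
  have hfac : ∀ p ∈ N.primeFactors, (1 - (p : ℝ) ^ (-(1 / 2 : ℝ)))⁻¹ ≤ 4 := by
    intro p hp
    have hpp : p.Prime := Nat.prime_of_mem_primeFactors hp
    have hp2 : (2 : ℝ) ≤ p := by exact_mod_cast hpp.two_le
    have hle : (p : ℝ) ^ (-(1 / 2 : ℝ)) ≤ 3 / 4 :=
      le_trans (Real.rpow_le_rpow_of_nonpos (by norm_num) hp2 (by norm_num)) h2
    have hpos : (0 : ℝ) < 1 - (p : ℝ) ^ (-(1 / 2 : ℝ)) := by linarith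
    rw [inv_le_comm₀ hpos (by norm_num)]
    linarith
  have hnonneg : ∀ p ∈ N.primeFactors, 0 ≤ (1 - (p : ℝ) ^ (-(1 / 2 : ℝ)))⁻¹ := by
    intro p hp
    have hpp : p.Prime := Nat.prime_of_mem_primeFactors hp
    have hp2 : (2 : ℝ) ≤ p := by exact_mod_cast hpp.two_le
    have hle : (p : ℝ) ^ (-(1 / 2 : ℝ)) ≤ 3 / 4 :=
      le_trans (Real.rpow_le_rpow_of_nonpos (by norm_num) hp2 (by norm_num)) h2
    exact inv_nonneg.2 (by linarith)
  calc ∏ p ∈ N.primeFactors, (1 - (p : ℝ) ^ (-(1 / 2 : ℝ)))⁻¹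
      ≤ ∏ _p ∈ N.primeFactors, (4 : ℝ) := Finset.prod_le_prod hnonneg hfac
    _ = (4 : ℝ) ^ N.primeFactors.card := Finset.prod_const _

/-- The reciprocal sum over `s ≤ S` with large `N`-smooth part: by the injection `s ↦ ((s,N^∞), s/(s,N^∞))`
and Rankin's trick at `σ = 1/2`,
`∑_{s ≤ S, (s,N^∞) > Pm} 1/s ≤ Pm^{-1/2} 4^{ω(N)} ∑_{t ≤ S} 1/t`. [folklore] -/
theorem sum_inv_filter_smoothComponent_le {N : ℕ} (hN : N ≠ 0) {Pm : ℕ} (hPm : 1 ≤ Pm) (S : ℝ) :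
    ∑ s ∈ (Icc 1 ⌊S⌋₊).filter (fun s : ℕ => Pm < smoothComponent N s), (1 : ℝ) / s ≤
      (Pm : ℝ) ^ (-(1 / 2 : ℝ)) * (4 : ℝ) ^ N.primeFactors.card * ∑ t ∈ Icc 1 ⌊S⌋₊, (1 : ℝ) / t := by
  set T := (Icc 1 ⌊S⌋₊).filter (fun s : ℕ => Pm < smoothComponent N s) with hT
  set Pset := (Icc 1 ⌊S⌋₊).filter
    (fun P : ℕ => P ∈ Nat.factoredNumbers N.primeFactors ∧ Pm < P) with hPset
  set e : ℕ → ℕ × ℕ := fun s => (smoothComponent N s, roughComponent N s) with he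
  -- the injection
  have hinj : Set.InjOn e (T : Set ℕ) := by
    intro s₁ hs₁ s₂ hs₂ h
    rw [Finset.mem_coe, hT, Finset.mem_filter, Finset.mem_Icc] at hs₁ hs₂
    simp only [he, Prod.mk.injEq] at h
    rw [← smoothComponent_mul_roughComponent N (by omega : s₁ ≠ 0),
      ← smoothComponent_mul_roughComponent N (by omega : s₂ ≠ 0), h.1, h.2]
  have himg : T.image e ⊆ Pset ×ˢ Icc 1 ⌊S⌋₊ := by
    intro x hx
    rw [Finset.mem_image] at hx
    obtain ⟨s, hs, rfl⟩ := hx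
    rw [hT, Finset.mem_filter, Finset.mem_Icc] at hs
    obtain ⟨⟨hs1, hsS⟩, hPm'⟩ := hs
    have hs0 : s ≠ 0 := by omega
    have hdec := smoothComponent_mul_roughComponent N hs0
    have hsp : smoothComponent N s ≤ s := Nat.le_of_dvd (by omega) ⟨_, hdec.symm⟩
    have hrp : roughComponent N s ≤ s := Nat.le_of_dvd (by omega) ⟨_, (mul_comm _ _).trans hdec |>.symm⟩
    simp only [he, Finset.mem_product, hPset, Finset.mem_filter, Finset.mem_Icc]
    exact ⟨⟨⟨Nat.pos_of_ne_zero (smoothComponent_ne_zero N s), hsp.trans hsS⟩,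
      smoothComponent_mem_factoredNumbers hN s, hPm'⟩,
      Nat.pos_of_ne_zero (roughComponent_ne_zero N s), hrp.trans hsS⟩
  -- rewrite the sum through the injection
  have hsum : ∑ s ∈ T, (1 : ℝ) / s = ∑ x ∈ T.image e, (1 : ℝ) / ((x.1 : ℝ) * x.2) := by
    rw [Finset.sum_image hinj]
    refine Finset.sum_congr rfl fun s hs => ?_
    rw [hT, Finset.mem_filter, Finset.mem_Icc] at hs
    simp only [he]
    rw [← Nat.cast_mul, smoothComponent_mul_roughComponent N (by omega : s ≠ 0)]
  rw [hsum]
  calc ∑ x ∈ T.image e, (1 : ℝ) / ((x.1 : ℝ) * x.2)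
      ≤ ∑ x ∈ Pset ×ˢ Icc 1 ⌊S⌋₊, (1 : ℝ) / ((x.1 : ℝ) * x.2) :=
        Finset.sum_le_sum_of_subset_of_nonneg himg fun _ _ _ => by positivity
    _ = (∑ P ∈ Pset, (1 : ℝ) / P) * ∑ t ∈ Icc 1 ⌊S⌋₊, (1 : ℝ) / t := by
        rw [Finset.sum_product, Finset.sum_mul_sum]
        refine Finset.sum_congr rfl fun P _ => Finset.sum_congr rfl fun t _ => ?_
        rw [one_div_mul_one_div]
    _ ≤ ((Pm : ℝ) ^ (-(1 / 2 : ℝ)) * (4 : ℝ) ^ N.primeFactors.card) * ∑ t ∈ Icc 1 ⌊S⌋₊, (1 : ℝ) / t := by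
        refine mul_le_mul_of_nonneg_right ?_ (Finset.sum_nonneg fun _ _ => by positivity)
        have hprimes : ∀ p ∈ N.primeFactors, p.Prime := fun p hp => Nat.prime_of_mem_primeFactors hp
        have hZ : (0 : ℝ) < (Pm : ℝ) := by exact_mod_cast hPm
        have hmem : ∀ n ∈ Pset, n ∈ Nat.factoredNumbers N.primeFactors ∧ (Pm : ℝ) ≤ n := by
          intro n hn
          rw [hPset, Finset.mem_filter] at hn
          exact ⟨hn.2.1, by exact_mod_cast hn.2.2.le⟩
        have hR := RankinComposed.sum_inv_le_rankin hprimes (by norm_num : (0 : ℝ) < 1 / 2)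
          (by norm_num : (1 / 2 : ℝ) ≤ 1) hZ hmem
        have e2 : (-(1 - 1 / 2 : ℝ)) = -(1 / 2 : ℝ) := by norm_num
        rw [e2] at hR
        exact hR.trans (mul_le_mul_of_nonneg_left (prod_primeFactors_rankin_le N) (by positivity))

/-! ### Residue classes as Bombieri–Vinogradov prefixes; multiplicity of a modulus -/

/-- Summing over one residue class `a (mod d)`, `a < d`, in `[1, Y']`: the bottom term `m = a` plus the
prefix `m = d n + a`, `1 ≤ n ≤ (Y' - a)/d`. [folklore] -/
theorem sum_Icc_filter_modEq (f : ℕ → ℝ) {d : ℕ} (hd : 1 ≤ d) {a : ℕ} (ha : a < d) (Y' : ℕ) :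
    ∑ m ∈ (Icc 1 Y').filter (fun m : ℕ => m ≡ a [MOD d]), f m =
      (if 1 ≤ a ∧ a ≤ Y' then f a else 0) + ∑ n ∈ Icc 1 ((Y' - a) / d), f (d * n + a) := by
  set F := (Icc 1 Y').filter (fun m : ℕ => m ≡ a [MOD d]) with hF
  have hmemF : ∀ m : ℕ, m ∈ F ↔ (1 ≤ m ∧ m ≤ Y') ∧ m % d = a := by
    intro m
    rw [hF, Finset.mem_filter, Finset.mem_Icc, Nat.ModEq, Nat.mod_eq_of_lt ha]
  -- peel off `m = a`
  have hpeel : ∑ m ∈ F, f m = (if 1 ≤ a ∧ a ≤ Y' then f a else 0) + ∑ m ∈ F.erase a, f m := by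
    by_cases haF : a ∈ F
    · rw [← Finset.add_sum_erase F f haF, if_pos ((hmemF a).1 haF).1]
    · rw [Finset.erase_eq_of_notMem haF]
      have : ¬ (1 ≤ a ∧ a ≤ Y') := fun h => haF ((hmemF a).2 ⟨h, Nat.mod_eq_of_lt ha⟩)
      rw [if_neg this, zero_add]
  rw [hpeel]
  congr 1
  refine Finset.sum_nbij' (fun m => m / d) (fun n => d * n + a) ?_ ?_ ?_ ?_ ?_
  · intro m hm
    rw [Finset.mem_erase, hmemF] at hm
    obtain ⟨hma, ⟨hm1, hmY⟩, hmod⟩ := hm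
    have hdecomp : d * (m / d) + a = m := by rw [← hmod]; exact Nat.div_add_mod m d
    have hdecomp' : (m / d) * d + a = m := by rw [mul_comm]; exact hdecomp
    rw [Finset.mem_Icc]
    constructor
    · rcases Nat.eq_zero_or_pos (m / d) with h0 | h0
      · rw [h0, mul_zero, zero_add] at hdecomp
        exact absurd hdecomp.symm hma
      · exact h0
    · rw [Nat.le_div_iff_mul_le hd]
      omega
  · intro n hn
    rw [Finset.mem_Icc] at hn
    rw [Finset.mem_erase, hmemF]
    have hle : d * ((Y' - a) / d) ≤ Y' - a := Nat.mul_div_le _ _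
    have hn2 : d * n ≤ d * ((Y' - a) / d) := Nat.mul_le_mul_left d hn.2
    have hdn : d ≤ d * n := Nat.le_mul_of_pos_right d hn.1
    refine ⟨by omega, ⟨by omega, by omega⟩, ?_⟩
    rw [Nat.add_comm, Nat.add_mul_mod_self_left, Nat.mod_eq_of_lt ha]
  · intro m hm
    rw [Finset.mem_erase, hmemF] at hm
    obtain ⟨-, -, hmod⟩ := hm
    show d * (m / d) + a = m
    rw [← hmod]
    exact Nat.div_add_mod m d
  · intro n hn
    show (d * n + a) / d = n
    rw [Nat.mul_add_div hd, Nat.div_eq_of_lt ha, add_zero]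
  · intro m hm
    rw [Finset.mem_erase, hmemF] at hm
    obtain ⟨-, -, hmod⟩ := hm
    show f m = f (d * (m / d) + a)
    congr 1
    rw [← hmod]
    exact (Nat.div_add_mod m d).symm

/-- Multiplicity of a modulus: `#{(q, r, s) ∈ [1,Q]×[1,R₀]×[1,S₀] : lcm(rs, q) = d} ≤ τ(d)³`. [folklore] -/
theorem card_lcm_fiber_le (Q R₀ S₀ : ℕ) {d : ℕ} (hd : d ≠ 0) :
    ((Icc 1 Q ×ˢ (Icc 1 R₀ ×ˢ Icc 1 S₀)).filter
        (fun t : ℕ × ℕ × ℕ => Nat.lcm (t.2.1 * t.2.2) t.1 = d)).card ≤ (σ 0 d) ^ 3 := by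
  calc ((Icc 1 Q ×ˢ (Icc 1 R₀ ×ˢ Icc 1 S₀)).filter
        (fun t : ℕ × ℕ × ℕ => Nat.lcm (t.2.1 * t.2.2) t.1 = d)).card
      ≤ (d.divisors ×ˢ (d.divisors ×ˢ d.divisors)).card := by
        refine Finset.card_le_card fun t ht => ?_
        rw [Finset.mem_filter] at ht
        obtain ⟨-, hl⟩ := ht
        simp only [Finset.mem_product, Nat.mem_divisors]
        refine ⟨⟨?_, hd⟩, ⟨?_, hd⟩, ⟨?_, hd⟩⟩
        · rw [← hl]; exact Nat.dvd_lcm_right _ _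
        · rw [← hl]; exact (Dvd.intro _ rfl).trans (Nat.dvd_lcm_left _ _)
        · rw [← hl]; exact (Dvd.intro_left _ rfl).trans (Nat.dvd_lcm_left _ _)
    _ = (σ 0 d) ^ 3 := by
        rw [Finset.card_product, Finset.card_product, ArithmeticFunction.sigma_zero_apply]; ring

/-! ### Dyadic cut and numerics -/

/-- L10 — the dyadic cut: for `T > 0` and real `S` there is `J` with `S/2^J ≤ 2T`, and `J = 0 ∨ T < S/2^J`,
and `2^J ≤ max 1 (S/T)`. [folklore] -/
theorem exists_dyadic_cut {S T : ℝ} (hT : 0 < T) :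
    ∃ J : ℕ, S / 2 ^ J ≤ 2 * T ∧ (J = 0 ∨ T < S / 2 ^ J) ∧ (2 : ℝ) ^ J ≤ max 1 (S / T) := by
  by_cases h : S ≤ 2 * T
  · exact ⟨0, by simpa using h, Or.inl rfl, by simp⟩
  push Not at h
  have hex : ∃ n : ℕ, S / 2 ^ n ≤ 2 * T := by
    obtain ⟨n, hn⟩ := pow_unbounded_of_one_lt (S / (2 * T)) (one_lt_two (α := ℝ))
    refine ⟨n, ?_⟩
    rw [div_le_iff₀ (by positivity)]
    rw [div_lt_iff₀ (by positivity)] at hn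
    linarith
  classical
  refine ⟨Nat.find hex, Nat.find_spec hex, ?_, ?_⟩
  · right
    have hJ0 : Nat.find hex ≠ 0 := by
      intro h0
      have := Nat.find_spec hex
      rw [h0, pow_zero, div_one] at this
      linarith
    obtain ⟨J, hJ⟩ := Nat.exists_eq_succ_of_ne_zero hJ0
    have hmin := Nat.find_min hex (m := J) (by omega)
    push Not at hmin
    rw [hJ, pow_succ, ← div_div, lt_div_iff₀ (two_pos : (0 : ℝ) < 2)]
    linarith
  · refine le_trans ?_ (le_max_right _ _)
    have hJ0 : Nat.find hex ≠ 0 := by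
      intro h0
      have := Nat.find_spec hex
      rw [h0, pow_zero, div_one] at this
      linarith
    obtain ⟨J, hJ⟩ := Nat.exists_eq_succ_of_ne_zero hJ0
    have hmin := Nat.find_min hex (m := J) (by omega)
    push Not at hmin
    -- `2T < S/2^J`, so `2^(J+1) = 2 · 2^J < S/T`
    rw [hJ, pow_succ]
    rw [lt_div_iff₀ (by positivity)] at hmin
    rw [le_div_iff₀ hT]
    nlinarith [pow_pos (two_pos : (0 : ℝ) < 2) J]

/-- `x^{1-κ} L^B ≤ x / L^A` once `L^{A+B} ≤ x^κ` (`x > 0`, `L > 0`). [folklore] -/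
theorem rpow_one_sub_mul_log_rpow_le {x L A B κ : ℝ} (hx : 0 < x) (hL : 0 < L) (h : L ^ (A + B) ≤ x ^ κ) :
    x ^ (1 - κ) * L ^ B ≤ x / L ^ A := by
  have hLA : 0 < L ^ A := Real.rpow_pos_of_pos hL A
  rw [le_div_iff₀ hLA, mul_assoc, ← Real.rpow_add hL, add_comm B A]
  calc x ^ (1 - κ) * L ^ (A + B) ≤ x ^ (1 - κ) * x ^ κ :=
        mul_le_mul_of_nonneg_left h (by positivity)
    _ = x := by rw [← Real.rpow_add hx]; norm_num

/-- Monotonicity of the threshold: `L^{A+B} ≤ x^κ` from `L^{A+18} ≤ x^{ρ/2}` when `B ≤ 18`,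
`ρ/2 ≤ κ`, `L, x ≥ 1`. [folklore] -/
theorem log_rpow_threshold_mono {x L A B κ ρ : ℝ} (hx : 1 ≤ x) (hL : 1 ≤ L) (hB : B ≤ 18)
    (hκ : ρ / 2 ≤ κ) (h : L ^ (A + 18) ≤ x ^ (ρ / 2)) : L ^ (A + B) ≤ x ^ κ :=
  calc L ^ (A + B) ≤ L ^ (A + 18) := Real.rpow_le_rpow_of_exponent_le hL (by linarith)
    _ ≤ x ^ (ρ / 2) := h
    _ ≤ x ^ κ := Real.rpow_le_rpow_of_exponent_le hx hκ

/-- `C x / L^{A+1} ≤ |C| x / L^A` for `x ≥ 0`, `L ≥ 1`. [folklore] -/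
theorem mul_div_log_rpow_succ_le (C A : ℝ) {x L : ℝ} (hx : 0 ≤ x) (hL : 1 ≤ L) :
    C * x / L ^ (A + 1) ≤ |C| * (x / L ^ A) := by
  have hL0 : 0 < L := by linarith
  calc C * x / L ^ (A + 1) ≤ |C| * x / L ^ (A + 1) := by gcongr; exact le_abs_self _
    _ = |C| * (x / L ^ (A + 1)) := by ring
    _ ≤ |C| * (x / L ^ A) := by
        refine mul_le_mul_of_nonneg_left ?_ (abs_nonneg _)
        exact div_le_div_of_nonneg_left hx (Real.rpow_pos_of_pos hL0 A)
          (Real.rpow_le_rpow_of_exponent_le hL (by linarith))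

end DispersionAssembly

end Literature.NumberTheory.Sieve

end
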